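import Summits.QuantumFields.BalabanUV.Beta.EriceFlowEnclosureB12AsPrintedPointwiseFadingLimit

/-!
# Beta / EriceFlowEnclosureB12AsPrintedPointwiseFadingLimitSharp — WHAT (0.31) FORCES, part 11b: THE EVENTUAL SHARP (0.31) AND THE BARE COUPLING.  Part 11
# (`…PointwiseFadingLimit`) showed that under node U2's moduli `HistLipschitz ∕ FadingMemory` and NE4 `ScaleShiftRate` (0 ≤ θ < 1) alone every β-function is within
# `η(δ, k) = 2Cδ∕(1−θ) + cθ^k∕(1−θ)` of ONE number `b⋆` on ]0, δ]^{k+1}.  Telescoping (0.20) p. 256 along any run inside ]0, δ]: §1 **`sharp031_window`** — for `k₀ ≤ k ≤ n ≤ K`,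
#   **`(b⋆ − η)(n − k) ≤ 1∕g_k² − 1∕g_n² ≤ (b⋆ + η)(n − k)`,  η = η(δ, k₀)**
# i.e. the discrete two-sided (0.31) holds EVENTUALLY with the constants `(b⋆ − η, b⋆ + η)` (`sharp031_at_endpoint`: `Step.Discrete031`'s two inequalities relative to the endpoint for every
# `k₀ ≤ k ≤ K`), and **`exists_sharp031`**: for every ε > 0 there are a box δ and a threshold k₀ such that EVERY run of (0.20) inside ]0, δ], of any depth, obeys (0.31) on the scales ≥ k₀ with
# constants `b⋆ ∓ ε` — the ratio of print's two constants can be taken as close to 1 as we please near zero coupling and deep in the ultraviolet.  §2 THE BARE COUPLING: for ANY family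
# `r K` (K = depth) of runs of (0.20) inside a box ]0, δ₀] carrying a positive eventual floor (node U2's `EventualLowerH b δ₀ k₁ β`, b > 0 — near zero a CONSEQUENCE of the typed Theorem 2,
# part 10b; or of `b⋆ > 0`, `eventualLowerH_of_bstar_pos`), the total running per step converges to the one number:
#   **`(1∕r_K(0)² − 1∕r_K(K)²) ∕ K ⟶ b⋆`  (K → ∞)**   (`tendsto_totalRunning_div`),
# whatever the infrared values `r_K(K) ∈ ]0, δ₀]` do; for families PINNED in the infrared (`r_K(K) = g`, Theorem 2's rows) **`K · r_K(0)² ⟶ 1∕b⋆`** (`tendsto_mul_bare_sq`): the bare coupling of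
# every tuned family is asymptotically free with THE SAME coefficient `b⋆`, independent of the pin.  Mechanism: the floor confines the run below δ except on the last `N(δ) ≍ 1∕(bδ²)` scales before
# the pin (`run_le_of_far`); fading memory forgets the first k₁ (floor-less) entries at rate `k₁Cδ₀θ^{j−k₁}` (`abs_beta_prefix_sub_bstar_le_far`); the remaining `K − O(1)` β-values are within
# `3ε∕8` of `b⋆`, the `O(1)` exceptional ones are bounded (`abs_beta_prefix_sub_bstar_le_crude`)
# (β-flow team, prover 2 = lower ∕ positivity side, unit `b2b-balaban-beta-bflow-p2`, gen 49; ROW AP-I × node U2's letters; kernel of part 11, third file)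

HONEST FRAMING (page 1 of everything the β sub-cell writes): discharging `BetaPertH` makes Bałaban's UV stability UNCONDITIONAL — a
real constructive-QFT result; it is NOT the continuum limit and NOT the Clay problem.  HONEST DEPENDENCY (cell reorg 2026-08-19,
verbatim): «continuum YM on T⁴ ⇐ BetaPertH ∧ nine spine estimates (0/9 proved); BetaPertH ⇐ (D1) ∧ (D4) ∧ CAP+tail; G-an2-4 gates
asym, D1 and NE2/3/4.»  THIS MODULE DISCHARGES NOTHING: [folklore] finite-sum ∕ limit calculus for an ABSTRACT `β : FlowStep.HBeta` under node U2's HYPOTHESIS SHAPES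
`T4CouplingMatching.HistLipschitz ∕ FadingMemory ∕ ScaleShiftRate ∕ EventualLowerH` (NONE printed — [Balaban1987RG1] = T. Bałaban, Commun. Math. Phys. **109** (1987) p. 298 ∕ p. 264;
GAPS G-t4-U2-1 ∕ G-t4-U2-2) and DISPLAYED runs of the printed recursion (0.20) p. 256 (`FlowStep.RGEqH`, `Step.InInterval`); node U2's `inv_sq_lower_of_eventualLower` and part 11's
`abs_beta_sub_bstar_le ∕ eventualLowerH_bstar ∕ eventualUpper_bstar ∕ exists_sandwich` BY NAME.  `b⋆` is carried as a real number with its defining property displayed (`hb`, part 11's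
`exists_bstar`).  «(0.31) with constants b⋆ ∓ ε» is a statement about ABSTRACT runs under these letters, NOT about Bałaban's (0.31), whose constants print does not relate to each other.
Nothing of Bałaban's objects is asserted.

WHAT THIS FILE PROVES (0 sorry, 0 def):
§1 **`sharp031_window`**, `sharp031_at_endpoint`, **`exists_sharp031`** (the eventual sharp (0.31): constants `b⋆ ∓ ε`).
§2 `run_le_of_far` (the floor confines the run below δ except on the last N(δ) scales), `abs_beta_prefix_sub_bstar_le_crude`, **`abs_beta_prefix_sub_bstar_le_far`**,
   **`tendsto_totalRunning_div`** (`(1∕r_K(0)² − 1∕r_K(K)²)∕K → b⋆`), **`tendsto_mul_bare_sq`** (pinned: `K·r_K(0)² → 1∕b⋆`), `eventualLowerH_of_bstar_pos` (the floor from `b⋆ > 0` on a small box).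
NOT CLAIMED: any letter, limit or asymptotics for Bałaban's β or bare couplings; which reading print intends; Theorem 2; `BetaPertH`; continuum; Clay.
-/

namespace Summit.QuantumFields.BalabanUV.Beta.EriceFlowEnclosureB12AsPrintedPointwiseFadingLimitSharp

open Finset Filter Topology
open Literature.MathematicalPhysics.QuantumFieldTheory.Balaban1983to89
open Literature.MathematicalPhysics.QuantumFieldTheory.Balaban1983to89.FlowStep (HBeta prefixOf Box mem_box box_mono RGEqH inv_sq_telescopeH)
open Literature.MathematicalPhysics.QuantumFieldTheory.Balaban1983to89.T4CouplingMatching (HistLipschitz FadingMemory ScaleShiftRate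
  EventualLowerH inv_sq_lower_of_eventualLower)
open Literature.MathematicalPhysics.QuantumFieldTheory.Balaban1983to89.T4BetaStationary (SeqBox betaInf constant_nonneg_of_scaleShiftRate)
open Summit.QuantumFields.BalabanUV.Beta.EriceFlowEnclosureB12AsPrintedTunedUpper (prefixOf_mem_box_of_inInterval)
open Summit.QuantumFields.BalabanUV.Beta.EriceFlowEnclosureB12AsPrintedPointwiseFadingLimit

noncomputable section

variable {β : HBeta} {γ C c θ : ℝ} {Λ : ℕ → ℕ → ℝ}

/-! ## §1 The eventual sharp (0.31): constants `(b⋆ − η, b⋆ + η)` along every run inside a small box -/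

/-- **THE EVENTUAL SHARP (0.31), WINDOW FORM.**  Node U2's moduli + NE4 (0 ≤ θ < 1, 0 ≤ C), `b⋆` the asymptotic constant (`hb`), `0 < δ ≤ γ`, a run r of (0.20) up to depth K inside ]0, δ]
(`RGEqH K β r`, `Step.InInterval δ K r`) ⟹ for all `k₀ ≤ k ≤ n ≤ K`, with `η = 2Cδ∕(1−θ) + cθ^{k₀}∕(1−θ)`:
`(b⋆ − η)(n − k) ≤ 1∕r_k² − 1∕r_n² ≤ (b⋆ + η)(n − k)` (telescoped (0.20) + part 11's sandwich on every prefix). [cite: Balaban1987RG1, (0.20) p.256, (0.31) p.259] -/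
theorem sharp031_window (hL : HistLipschitz Λ γ β) (hΛ : FadingMemory C θ Λ) (hS : ScaleShiftRate c θ γ β)
    (hθ0 : 0 ≤ θ) (hθ1 : θ < 1) (hC : 0 ≤ C) {bstar : ℝ}
    (hb : ∀ u : ℝ, 0 < u → u ≤ γ → |betaInf β (fun _ : ℕ => u) - bstar| ≤ C * u / (1 - θ))
    {δ : ℝ} (hδ : 0 < δ) (hδγ : δ ≤ γ) {K : ℕ} {r : ℕ → ℝ} (hrg : RGEqH K β r) (hI : Step.InInterval δ K r)
    {k₀ k n : ℕ} (hk : k₀ ≤ k) (hkn : k ≤ n) (hn : n ≤ K) :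
    (bstar - (2 * C * δ / (1 - θ) + c * θ ^ k₀ / (1 - θ))) * ((n : ℝ) - k) ≤ 1 / (r k) ^ 2 - 1 / (r n) ^ 2 ∧
      1 / (r k) ^ 2 - 1 / (r n) ^ 2 ≤ (bstar + (2 * C * δ / (1 - θ) + c * θ ^ k₀ / (1 - θ))) * ((n : ℝ) - k) := by
  set η : ℝ := 2 * C * δ / (1 - θ) + c * θ ^ k₀ / (1 - θ) with hη
  have htel := inv_sq_telescopeH hrg hkn hn
  have hlow := eventualLowerH_bstar hL hΛ hS hθ0 hθ1 hC hb hδ hδγ k₀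
  have hup := eventualUpper_bstar hL hΛ hS hθ0 hθ1 hC hb hδ hδγ k₀
  have hbox : ∀ j ∈ Ico k n, prefixOf r j ∈ Box δ j := fun j hj =>
    prefixOf_mem_box_of_inInterval hI ((mem_Ico.mp hj).2.le.trans hn)
  have hge : ∀ j ∈ Ico k n, bstar - η ≤ β j (prefixOf r j) := fun j hj =>
    hlow j _ (hk.trans (mem_Ico.mp hj).1) (hbox j hj)
  have hle : ∀ j ∈ Ico k n, β j (prefixOf r j) ≤ bstar + η := fun j hj =>
    hup j _ (hk.trans (mem_Ico.mp hj).1) (hbox j hj)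
  have hcard : (((Ico k n).card : ℕ) : ℝ) = (n : ℝ) - k := by
    rw [Nat.card_Ico, Nat.cast_sub hkn]
  have hsum_ge := Finset.card_nsmul_le_sum (Ico k n) (fun j => β j (prefixOf r j)) (bstar - η) hge
  have hsum_le := Finset.sum_le_card_nsmul (Ico k n) (fun j => β j (prefixOf r j)) (bstar + η) hle
  rw [nsmul_eq_mul, hcard] at hsum_ge hsum_le
  constructor <;> linarith [hsum_ge, hsum_le, htel]

/-- **THE EVENTUAL SHARP (0.31) RELATIVE TO THE ENDPOINT** (the two inequalities of `Step.Discrete031 (b⋆ − η) (b⋆ + η) K (r K) r`, for the scales `k₀ ≤ k ≤ K`):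
`1∕r_K² + (b⋆ − η)(K − k) ≤ 1∕r_k² ≤ 1∕r_K² + (b⋆ + η)(K − k)`. [cite: Balaban1987RG1, (0.20) p.256, (0.31) p.259] -/
theorem sharp031_at_endpoint (hL : HistLipschitz Λ γ β) (hΛ : FadingMemory C θ Λ) (hS : ScaleShiftRate c θ γ β)
    (hθ0 : 0 ≤ θ) (hθ1 : θ < 1) (hC : 0 ≤ C) {bstar : ℝ}
    (hb : ∀ u : ℝ, 0 < u → u ≤ γ → |betaInf β (fun _ : ℕ => u) - bstar| ≤ C * u / (1 - θ))
    {δ : ℝ} (hδ : 0 < δ) (hδγ : δ ≤ γ) {K : ℕ} {r : ℕ → ℝ} (hrg : RGEqH K β r) (hI : Step.InInterval δ K r)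
    {k₀ : ℕ} : ∀ k, k₀ ≤ k → k ≤ K →
      1 / (r K) ^ 2 + (bstar - (2 * C * δ / (1 - θ) + c * θ ^ k₀ / (1 - θ))) * ((K : ℝ) - k) ≤ 1 / (r k) ^ 2 ∧
      1 / (r k) ^ 2 ≤ 1 / (r K) ^ 2 + (bstar + (2 * C * δ / (1 - θ) + c * θ ^ k₀ / (1 - θ))) * ((K : ℝ) - k) := by
  intro k hk hkK
  have h := sharp031_window hL hΛ hS hθ0 hθ1 hC hb hδ hδγ hrg hI hk hkK le_rfl
  constructor <;> linarith [h.1, h.2]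

/-- **β′∕β → 1: THE EVENTUAL (0.31) WITH CONSTANTS `b⋆ ∓ ε`.**  Node U2's moduli + NE4 (0 ≤ θ < 1, 0 ≤ C, 0 < γ) and `b⋆` the asymptotic constant ⟹ for every ε > 0 there are a box
`0 < δ ≤ γ` and a threshold k₀ such that EVERY run of (0.20) inside ]0, δ], of ANY depth K, obeys `(b⋆ − ε)(n − k) ≤ 1∕r_k² − 1∕r_n² ≤ (b⋆ + ε)(n − k)` for all `k₀ ≤ k ≤ n ≤ K`.
[cite: Balaban1987RG1, (0.20) p.256, (0.31) p.259] -/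
theorem exists_sharp031 (hL : HistLipschitz Λ γ β) (hΛ : FadingMemory C θ Λ) (hS : ScaleShiftRate c θ γ β)
    (hθ0 : 0 ≤ θ) (hθ1 : θ < 1) (hC : 0 ≤ C) (hγ : 0 < γ) {bstar : ℝ}
    (hb : ∀ u : ℝ, 0 < u → u ≤ γ → |betaInf β (fun _ : ℕ => u) - bstar| ≤ C * u / (1 - θ)) {ε : ℝ} (hε : 0 < ε) :
    ∃ δ : ℝ, 0 < δ ∧ δ ≤ γ ∧ ∃ k₀ : ℕ, ∀ (K : ℕ) (r : ℕ → ℝ), RGEqH K β r → Step.InInterval δ K r →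
      ∀ k n : ℕ, k₀ ≤ k → k ≤ n → n ≤ K →
        (bstar - ε) * ((n : ℝ) - k) ≤ 1 / (r k) ^ 2 - 1 / (r n) ^ 2 ∧ 1 / (r k) ^ 2 - 1 / (r n) ^ 2 ≤ (bstar + ε) * ((n : ℝ) - k) := by
  obtain ⟨δ, hδ, hδγ, k₀, hk₀⟩ := exists_sandwich hL hΛ hS hθ0 hθ1 hC hγ hb hε
  refine ⟨δ, hδ, hδγ, k₀, fun K r hrg hI k n hk hkn hn => ?_⟩
  have htel := inv_sq_telescopeH hrg hkn hn
  have hbox : ∀ j ∈ Ico k n, prefixOf r j ∈ Box δ j := fun j hj =>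
    prefixOf_mem_box_of_inInterval hI ((mem_Ico.mp hj).2.le.trans hn)
  have hge : ∀ j ∈ Ico k n, bstar - ε ≤ β j (prefixOf r j) := fun j hj => by
    have := (abs_le.mp (hk₀ j _ (hk.trans (mem_Ico.mp hj).1) (hbox j hj))).1; linarith
  have hle : ∀ j ∈ Ico k n, β j (prefixOf r j) ≤ bstar + ε := fun j hj => by
    have := (abs_le.mp (hk₀ j _ (hk.trans (mem_Ico.mp hj).1) (hbox j hj))).2; linarith
  have hcard : (((Ico k n).card : ℕ) : ℝ) = (n : ℝ) - k := by
    rw [Nat.card_Ico, Nat.cast_sub hkn]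
  have hsum_ge := Finset.card_nsmul_le_sum (Ico k n) (fun j => β j (prefixOf r j)) (bstar - ε) hge
  have hsum_le := Finset.sum_le_card_nsmul (Ico k n) (fun j => β j (prefixOf r j)) (bstar + ε) hle
  rw [nsmul_eq_mul, hcard] at hsum_ge hsum_le
  constructor <;> linarith [hsum_ge, hsum_le, htel]

/-! ## §2 The bare coupling of every run family in a small box: `(1∕r_K(0)² − 1∕r_K(K)²)∕K → b⋆`, pinned `K·r_K(0)² → 1∕b⋆` -/

/-- **The floor confines the run below δ away from the pin.**  `EventualLowerH b δ₀ k₁ β` with `b > 0`, a run r of (0.20) up to K inside ]0, δ₀], `0 < δ`, and N with `1 ≤ b·N·δ²` ⟹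
`r_i ≤ δ` for every `k₁ ≤ i` with `i + N ≤ K` (node U2's `inv_sq_lower_of_eventualLower`: `1∕r_i² ≥ 1∕r_K² + b(K − i) ≥ bN ≥ 1∕δ²`). [cite: Balaban1987RG1, (0.20) p.256] -/
theorem run_le_of_far {b δ₀ δ : ℝ} {k₁ K N : ℕ} {r : ℕ → ℝ} (hfl : EventualLowerH b δ₀ k₁ β) (hbpos : 0 < b)
    (hrg : RGEqH K β r) (hI : Step.InInterval δ₀ K r) (hδ : 0 < δ) (hN : 1 ≤ b * N * δ ^ 2)
    {i : ℕ} (hk : k₁ ≤ i) (hiN : i + N ≤ K) : r i ≤ δ := by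
  have hiK : i ≤ K := le_trans (Nat.le_add_right i N) hiN
  have hri : 0 < r i := (hI i hiK).1
  have hrK : 0 < r K := (hI K le_rfl).1
  have hlow := inv_sq_lower_of_eventualLower hrg hI hfl hk hiK
  have hKi : (N : ℝ) ≤ ((K - i : ℕ) : ℝ) := by exact_mod_cast (by omega : N ≤ K - i)
  have h1 : 1 / δ ^ 2 ≤ 1 / (r i) ^ 2 := by
    have hpos : 0 < 1 / (r K) ^ 2 := by positivity
    have hbN : 1 / δ ^ 2 ≤ b * N := by
      rw [div_le_iff₀ (by positivity)]; linarith
    have hbKi : b * N ≤ b * ((K - i : ℕ) : ℝ) := mul_le_mul_of_nonneg_left hKi hbpos.le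
    linarith
  have h2 : (r i) ^ 2 ≤ δ ^ 2 := (one_div_le_one_div (by positivity) (by positivity)).mp h1
  nlinarith [h2, hri, hδ]

/-- **Crude bound at every scale**: under the moduli + NE4 and `hb`, every prefix of a run inside ]0, δ₀] (⊆ ]0, γ]) has `|β_{j+1}(r_{≤j}) − b⋆| ≤ 2Cδ₀∕(1−θ) + c∕(1−θ)` (part 11's sandwich with θ^j ≤ 1).
[folklore] -/
theorem abs_beta_prefix_sub_bstar_le_crude (hL : HistLipschitz Λ γ β) (hΛ : FadingMemory C θ Λ) (hS : ScaleShiftRate c θ γ β)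
    (hθ0 : 0 ≤ θ) (hθ1 : θ < 1) (hC : 0 ≤ C) {bstar : ℝ}
    (hb : ∀ u : ℝ, 0 < u → u ≤ γ → |betaInf β (fun _ : ℕ => u) - bstar| ≤ C * u / (1 - θ))
    {δ₀ : ℝ} (hδ₀ : 0 < δ₀) (hδ₀γ : δ₀ ≤ γ) {K : ℕ} {r : ℕ → ℝ} (hI : Step.InInterval δ₀ K r) {j : ℕ} (hj : j ≤ K) :
    |β j (prefixOf r j) - bstar| ≤ 2 * C * δ₀ / (1 - θ) + c / (1 - θ) := by
  have h1θ : 0 < 1 - θ := by linarith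
  have hc : 0 ≤ c := constant_nonneg_of_scaleShiftRate hS (hδ₀.trans_le hδ₀γ)
  have h := abs_beta_sub_bstar_le hL hΛ hS hθ0 hθ1 hC hb hδ₀ hδ₀γ (prefixOf_mem_box_of_inInterval hI hj)
  have hθj : c * θ ^ j / (1 - θ) ≤ c / (1 - θ) :=
    div_le_div_of_nonneg_right (by nlinarith [pow_le_one₀ hθ0 hθ1.le (n := j)]) h1θ.le
  linarith

/-- **THE FAR-FROM-THE-PIN ESTIMATE.**  Node U2's moduli + NE4 (0 ≤ θ < 1, 0 ≤ C), `hb`, a box `0 < δ₀ ≤ γ` with the floor `EventualLowerH b δ₀ k₁ β` (b > 0), a run r of (0.20) up to K inside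
]0, δ₀], a smaller box `0 < δ ≤ δ₀` and N with `1 ≤ bNδ²` ⟹ for every scale j with `k₁ ≤ j` and `j + N ≤ K`:
`|β_{j+1}(r_0, …, r_j) − b⋆| ≤ k₁·C·δ₀·θ^{j−k₁} + 2Cδ∕(1−θ) + cθ^j∕(1−θ)` — the entries `k₁ ≤ i ≤ j` are ≤ δ (`run_le_of_far`), the first k₁ entries (no floor there) are replaced by
`min(r_i, δ)` at the fading-memory cost `Σ_{i<k₁} Cθ^{j−i}δ₀`, and the modified prefix lies in ]0, δ]^{j+1} where part 11's sandwich applies. [cite: Balaban1987RG1, (0.20) p.256, §5 p.298] -/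
theorem abs_beta_prefix_sub_bstar_le_far (hL : HistLipschitz Λ γ β) (hΛ : FadingMemory C θ Λ) (hS : ScaleShiftRate c θ γ β)
    (hθ0 : 0 ≤ θ) (hθ1 : θ < 1) (hC : 0 ≤ C) {bstar : ℝ}
    (hb : ∀ u : ℝ, 0 < u → u ≤ γ → |betaInf β (fun _ : ℕ => u) - bstar| ≤ C * u / (1 - θ))
    {δ₀ b : ℝ} {k₁ : ℕ} (hδ₀ : 0 < δ₀) (hδ₀γ : δ₀ ≤ γ) (hfl : EventualLowerH b δ₀ k₁ β) (hbpos : 0 < b)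
    {K : ℕ} {r : ℕ → ℝ} (hrg : RGEqH K β r) (hI : Step.InInterval δ₀ K r)
    {δ : ℝ} (hδ : 0 < δ) (hδδ₀ : δ ≤ δ₀) {N : ℕ} (hN : 1 ≤ b * N * δ ^ 2) {j : ℕ} (hk : k₁ ≤ j) (hjN : j + N ≤ K) :
    |β j (prefixOf r j) - bstar| ≤ (k₁ : ℝ) * C * δ₀ * θ ^ (j - k₁) + 2 * C * δ / (1 - θ) + c * θ ^ j / (1 - θ) := by
  have hjK : j ≤ K := le_trans (Nat.le_add_right j N) hjN
  have hδγ : δ ≤ γ := hδδ₀.trans hδ₀γ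
  -- the modified prefix
  set p : Fin (j + 1) → ℝ := fun i => if (i : ℕ) < k₁ then min (r i) δ else r i with hp
  have hsmall : ∀ i : Fin (j + 1), k₁ ≤ (i : ℕ) → r i ≤ δ := fun i hi =>
    run_le_of_far hfl hbpos hrg hI hδ hN hi (by have := i.isLt; omega)
  have hrpos : ∀ i : Fin (j + 1), 0 < r i ∧ r i ≤ δ₀ := fun i => hI i ((Nat.le_of_lt_succ i.isLt).trans hjK)
  have hpbox : p ∈ Box δ j := by
    refine mem_box.mpr fun i => ?_
    by_cases hi : (i : ℕ) < k₁
    · simp only [hp, hi, if_true]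
      exact ⟨lt_min (hrpos i).1 hδ, min_le_right _ _⟩
    · simp only [hp, hi, if_false]
      exact ⟨(hrpos i).1, hsmall i (not_lt.mp hi)⟩
  have hrbox : prefixOf r j ∈ Box γ j := box_mono hδ₀γ j (prefixOf_mem_box_of_inInterval hI hjK)
  -- fading-memory cost of the modification: only the first k₁ entries move, each by ≤ δ₀ with weight ≤ Cθ^{j−k₁}
  have hmod : |β j (prefixOf r j) - β j p| ≤ (k₁ : ℝ) * C * δ₀ * θ ^ (j - k₁) := by
    have h := hL j (prefixOf r j) p hrbox (box_mono hδγ j hpbox)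
    have hterm : ∀ i : Fin (j + 1), Λ j i * |prefixOf r j i - p i| ≤ if (i : ℕ) < k₁ then C * θ ^ (j - k₁) * δ₀ else 0 := by
      intro i
      have hΛi := hΛ j i (Nat.le_of_lt_succ i.isLt)
      by_cases hi : (i : ℕ) < k₁
      · simp only [hp, hi, if_true, FlowStep.prefixOf_apply]
        have hdiff : |r i - min (r i) δ| ≤ δ₀ := by
          rw [abs_of_nonneg (sub_nonneg.mpr (min_le_left _ _))]
          linarith [(hrpos i).2, lt_min (hrpos i).1 hδ]
        have hθpow : θ ^ (j - (i : ℕ)) ≤ θ ^ (j - k₁) := pow_le_pow_of_le_one hθ0 hθ1.le (by omega)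
        calc Λ j i * |r i - min (r i) δ| ≤ C * θ ^ (j - (i : ℕ)) * δ₀ :=
              mul_le_mul hΛi.2 hdiff (abs_nonneg _) (by positivity)
          _ ≤ C * θ ^ (j - k₁) * δ₀ := by
              exact mul_le_mul_of_nonneg_right (mul_le_mul_of_nonneg_left hθpow hC) hδ₀.le
      · simp only [hp, hi, if_false, FlowStep.prefixOf_apply, sub_self, abs_zero, mul_zero, le_refl]
    have hsum : ∑ i : Fin (j + 1), Λ j i * |prefixOf r j i - p i| ≤ ∑ i : Fin (j + 1), (if (i : ℕ) < k₁ then C * θ ^ (j - k₁) * δ₀ else 0) :=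
      Finset.sum_le_sum fun i _ => hterm i
    have hite : ∑ i : Fin (j + 1), (if (i : ℕ) < k₁ then C * θ ^ (j - k₁) * δ₀ else 0) = (k₁ : ℝ) * (C * θ ^ (j - k₁) * δ₀) := by
      rw [Fin.sum_univ_eq_sum_range (fun i => if i < k₁ then C * θ ^ (j - k₁) * δ₀ else 0) (j + 1),
        Finset.range_eq_Ico, ← Finset.sum_Ico_consecutive _ (Nat.zero_le k₁) (by omega : k₁ ≤ j + 1)]
      have h1 : ∑ i ∈ Ico 0 k₁, (if i < k₁ then C * θ ^ (j - k₁) * δ₀ else 0) = ∑ i ∈ Ico 0 k₁, C * θ ^ (j - k₁) * δ₀ :=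
        Finset.sum_congr rfl fun i hi => if_pos (mem_Ico.mp hi).2
      have h2 : ∑ i ∈ Ico k₁ (j + 1), (if i < k₁ then C * θ ^ (j - k₁) * δ₀ else 0) = 0 :=
        Finset.sum_eq_zero fun i hi => if_neg (not_lt.mpr (mem_Ico.mp hi).1)
      rw [h1, h2, add_zero, Finset.sum_const, Nat.card_Ico, Nat.sub_zero, nsmul_eq_mul]
    rw [hite] at hsum
    calc |β j (prefixOf r j) - β j p| ≤ ∑ i : Fin (j + 1), Λ j i * |prefixOf r j i - p i| := h
      _ ≤ (k₁ : ℝ) * (C * θ ^ (j - k₁) * δ₀) := hsum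
      _ = (k₁ : ℝ) * C * δ₀ * θ ^ (j - k₁) := by ring
  -- part 11's sandwich on the modified prefix
  have hsand := abs_beta_sub_bstar_le hL hΛ hS hθ0 hθ1 hC hb hδ hδγ hpbox
  have htri := abs_sub_le (β j (prefixOf r j)) (β j p) bstar
  linarith
set_option maxHeartbeats 400000 in
/-- **THE BARE COUPLING OF EVERY RUN FAMILY IN A SMALL BOX.**  Node U2's moduli + NE4 (0 ≤ θ < 1, 0 ≤ C), `b⋆` the asymptotic constant, a box `0 < δ₀ ≤ γ` with a positive eventual floor
`EventualLowerH b δ₀ k₁ β` (b > 0), and a family `r K` of runs of (0.20) of depth K inside ]0, δ₀] (any infrared values) ⟹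
`(1∕r_K(0)² − 1∕r_K(K)²) ∕ K ⟶ b⋆` as `K → ∞`: the total running per step is asymptotically THE one number (all but `O(1)` of the K β-values along the run are within 3ε∕8 of `b⋆`,
`abs_beta_prefix_sub_bstar_le_far`; the rest are bounded, `abs_beta_prefix_sub_bstar_le_crude`). [cite: Balaban1987RG1, (0.20) p.256, Thm 2 (0.31) p.259, §5 p.298] -/
theorem tendsto_totalRunning_div (hL : HistLipschitz Λ γ β) (hΛ : FadingMemory C θ Λ) (hS : ScaleShiftRate c θ γ β)
    (hθ0 : 0 ≤ θ) (hθ1 : θ < 1) (hC : 0 ≤ C) {bstar : ℝ}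
    (hb : ∀ u : ℝ, 0 < u → u ≤ γ → |betaInf β (fun _ : ℕ => u) - bstar| ≤ C * u / (1 - θ))
    {δ₀ b : ℝ} {k₁ : ℕ} (hδ₀ : 0 < δ₀) (hδ₀γ : δ₀ ≤ γ) (hfl : EventualLowerH b δ₀ k₁ β) (hbpos : 0 < b)
    {r : ℕ → ℕ → ℝ} (hrg : ∀ K, RGEqH K β (r K)) (hI : ∀ K, Step.InInterval δ₀ K (r K)) :
    Tendsto (fun K : ℕ => (1 / (r K 0) ^ 2 - 1 / (r K K) ^ 2) / K) atTop (𝓝 bstar) := by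
  have h1θ : 0 < 1 - θ := by linarith
  have hγ : 0 < γ := hδ₀.trans_le hδ₀γ
  have hc : 0 <= c := constant_nonneg_of_scaleShiftRate hS hγ
  set M₀ : ℝ := 2 * C * δ₀ / (1 - θ) + c / (1 - θ) with hM₀
  have hM₀0 : 0 ≤ M₀ := by rw [hM₀]; positivity
  rw [Metric.tendsto_atTop]
  intro ε hε
  -- δ with 2Cδ/(1−θ) ≤ ε/8
  set δ : ℝ := min δ₀ (ε * (1 - θ) / (16 * (C + 1))) with hδdef
  have hδ : 0 < δ := lt_min hδ₀ (by positivity)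
  have hδδ₀ : δ ≤ δ₀ := min_le_left _ _
  have hδε : 2 * C * δ / (1 - θ) ≤ ε / 8 := by
    have h1 : δ ≤ ε * (1 - θ) / (16 * (C + 1)) := min_le_right _ _
    have h2 : 16 * (C + 1) * δ ≤ ε * (1 - θ) := by rwa [le_div_iff₀ (by positivity), mul_comm] at h1
    rw [div_le_iff₀ h1θ]; nlinarith [hδ.le]
  -- k₂ with cθ^{k₂}/(1−θ) ≤ ε/8
  obtain ⟨k₂, hk₂⟩ : ∃ k₂ : ℕ, c * θ ^ k₂ / (1 - θ) ≤ ε / 8 := by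
    rcases eq_or_lt_of_le hc with h0 | hcpos
    · exact ⟨0, by rw [← h0]; simp; positivity⟩
    · obtain ⟨k, hk⟩ := exists_pow_lt_of_lt_one (show 0 < ε / 8 * (1 - θ) / c by positivity) hθ1
      refine ⟨k, ?_⟩
      rw [div_le_iff₀ h1θ]
      have := (lt_div_iff₀ hcpos).mp hk
      linarith
  -- m with k₁Cδ₀θ^m ≤ ε/8
  obtain ⟨m, hm⟩ : ∃ m : ℕ, (k₁ : ℝ) * C * δ₀ * θ ^ m ≤ ε / 8 := by
    rcases eq_or_lt_of_le (show 0 ≤ (k₁ : ℝ) * C * δ₀ by positivity) with h0 | hpos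
    · exact ⟨0, by rw [← h0]; simp; positivity⟩
    · obtain ⟨m, hm⟩ := exists_pow_lt_of_lt_one (show 0 < ε / 8 / ((k₁ : ℝ) * C * δ₀) by positivity) hθ1
      refine ⟨m, ?_⟩
      have := (lt_div_iff₀ hpos).mp hm
      linarith
  -- N with 1 ≤ bNδ²
  obtain ⟨N, hN⟩ : ∃ N : ℕ, 1 ≤ b * N * δ ^ 2 := by
    obtain ⟨N, hN⟩ := exists_nat_ge (1 / (b * δ ^ 2))
    refine ⟨N, ?_⟩
    have hbd : 0 < b * δ ^ 2 := by positivity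
    have := (div_le_iff₀ hbd).mp hN
    linarith
  -- the good scales: J ≤ j, j + N ≤ K
  set J : ℕ := k₁ + m + k₂ with hJ
  have hgood : ∀ K j : ℕ, J ≤ j → j + N ≤ K → |β j (prefixOf (r K) j) - bstar| ≤ 3 * ε / 8 := by
    intro K j hJj hjN
    have hk₁j : k₁ ≤ j := by omega
    have h := abs_beta_prefix_sub_bstar_le_far hL hΛ hS hθ0 hθ1 hC hb hδ₀ hδ₀γ hfl hbpos (hrg K) (hI K) hδ hδδ₀ hN hk₁j hjN
    have hθ1' : (k₁ : ℝ) * C * δ₀ * θ ^ (j - k₁) ≤ (k₁ : ℝ) * C * δ₀ * θ ^ m :=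
      mul_le_mul_of_nonneg_left (pow_le_pow_of_le_one hθ0 hθ1.le (by omega)) (by positivity)
    have hθ2' : c * θ ^ j / (1 - θ) ≤ c * θ ^ k₂ / (1 - θ) :=
      div_le_div_of_nonneg_right (mul_le_mul_of_nonneg_left (pow_le_pow_of_le_one hθ0 hθ1.le (by omega)) hc) h1θ.le
    linarith
  have hcrude : ∀ K j : ℕ, j ≤ K → |β j (prefixOf (r K) j) - bstar| ≤ M₀ := fun K j hj =>
    abs_beta_prefix_sub_bstar_le_crude hL hΛ hS hθ0 hθ1 hC hb hδ₀ hδ₀γ (hI K) hj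
  -- K₀: beyond J + N and with (J+N)M₀/K ≤ ε/2
  obtain ⟨K₁, hK₁⟩ := exists_nat_gt (2 * ((J : ℝ) + N) * M₀ / ε)
  refine ⟨max (J + N + 1) K₁, fun K hK => ?_⟩
  have hKJN : J + N + 1 ≤ K := le_trans (le_max_left _ _) hK
  have hKK₁ : K₁ ≤ K := le_trans (le_max_right _ _) hK
  have hKpos : (0 : ℝ) < K := by exact_mod_cast (by omega : 0 < K)
  -- the total running is the sum of the β-values
  have htel := inv_sq_telescopeH (hrg K) (Nat.zero_le K) le_rfl
  have hsumeq : 1 / (r K 0) ^ 2 - 1 / (r K K) ^ 2 = ∑ j ∈ range K, β j (prefixOf (r K) j) := by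
    rw [htel, Finset.range_eq_Ico]; ring
  -- split the sum of deviations at J and K − N
  have hsplit : ∑ j ∈ range K, (β j (prefixOf (r K) j) - bstar) =
      ∑ j ∈ Ico 0 J, (β j (prefixOf (r K) j) - bstar) + ∑ j ∈ Ico J (K - N), (β j (prefixOf (r K) j) - bstar) +
        ∑ j ∈ Ico (K - N) K, (β j (prefixOf (r K) j) - bstar) := by
    rw [Finset.range_eq_Ico, ← Finset.sum_Ico_consecutive _ (Nat.zero_le J) (by omega : J ≤ K),
      ← Finset.sum_Ico_consecutive _ (by omega : J ≤ K - N) (by omega : K - N ≤ K)]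
    ring
  have hA : |∑ j ∈ Ico 0 J, (β j (prefixOf (r K) j) - bstar)| ≤ (J : ℝ) * M₀ := by
    refine (Finset.abs_sum_le_sum_abs _ _).trans ?_
    have h := Finset.sum_le_card_nsmul (Ico 0 J) (fun j => |β j (prefixOf (r K) j) - bstar|) M₀
      fun j hj => hcrude K j (by have := (mem_Ico.mp hj).2; omega)
    rwa [Nat.card_Ico, Nat.sub_zero, nsmul_eq_mul] at h
  have hB : |∑ j ∈ Ico J (K - N), (β j (prefixOf (r K) j) - bstar)| ≤ ((K : ℝ) - N - J) * (3 * ε / 8) := by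
    refine (Finset.abs_sum_le_sum_abs _ _).trans ?_
    have h := Finset.sum_le_card_nsmul (Ico J (K - N)) (fun j => |β j (prefixOf (r K) j) - bstar|) (3 * ε / 8)
      fun j hj => hgood K j (mem_Ico.mp hj).1 (by have := (mem_Ico.mp hj).2; omega)
    rw [Nat.card_Ico, nsmul_eq_mul] at h
    have hcast : (((K - N - J : ℕ) : ℝ)) = (K : ℝ) - N - J := by
      rw [Nat.cast_sub (by omega : J ≤ K - N), Nat.cast_sub (by omega : N ≤ K)]
    rwa [hcast] at h
  have hCsum : |∑ j ∈ Ico (K - N) K, (β j (prefixOf (r K) j) - bstar)| ≤ (N : ℝ) * M₀ := by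
    refine (Finset.abs_sum_le_sum_abs _ _).trans ?_
    have h := Finset.sum_le_card_nsmul (Ico (K - N) K) (fun j => |β j (prefixOf (r K) j) - bstar|) M₀
      fun j hj => hcrude K j (mem_Ico.mp hj).2.le
    rw [Nat.card_Ico, nsmul_eq_mul] at h
    have hcast : (((K - (K - N) : ℕ) : ℝ)) = (N : ℝ) := by
      rw [show K - (K - N) = N by omega]
    rwa [hcast] at h
  have hdev : |∑ j ∈ range K, (β j (prefixOf (r K) j) - bstar)| ≤ ((J : ℝ) + N) * M₀ + (K : ℝ) * (3 * ε / 8) := by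
    rw [hsplit]
    have t1 := abs_add_le (∑ j ∈ Ico 0 J, (β j (prefixOf (r K) j) - bstar) + ∑ j ∈ Ico J (K - N), (β j (prefixOf (r K) j) - bstar))
      (∑ j ∈ Ico (K - N) K, (β j (prefixOf (r K) j) - bstar))
    have t2 := abs_add_le (∑ j ∈ Ico 0 J, (β j (prefixOf (r K) j) - bstar)) (∑ j ∈ Ico J (K - N), (β j (prefixOf (r K) j) - bstar))
    have hNJ : ((K : ℝ) - N - J) * (3 * ε / 8) ≤ (K : ℝ) * (3 * ε / 8) := by
      have : (0 : ℝ) ≤ N := Nat.cast_nonneg N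
      have : (0 : ℝ) ≤ J := Nat.cast_nonneg J
      nlinarith
    nlinarith [hA, hB, hCsum, t1, t2, hNJ, hM₀0]
  -- the deviation of the mean
  have hmean : (1 / (r K 0) ^ 2 - 1 / (r K K) ^ 2) / K - bstar = (∑ j ∈ range K, (β j (prefixOf (r K) j) - bstar)) / K := by
    rw [hsumeq, Finset.sum_sub_distrib, Finset.sum_const, Finset.card_range, nsmul_eq_mul]
    field_simp
  rw [Real.dist_eq, hmean, abs_div, abs_of_pos hKpos, div_lt_iff₀ hKpos]
  have hK₁' : 2 * ((J : ℝ) + N) * M₀ / ε < K := lt_of_lt_of_le hK₁ (by exact_mod_cast hKK₁)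
  have hJN : ((J : ℝ) + N) * M₀ < ε / 2 * K := by
    have := (div_lt_iff₀ hε).mp hK₁'
    linarith
  have hεK : 0 < ε * K := mul_pos hε hKpos
  linarith [hdev]

/-- **PINNED FAMILIES: `K · r_K(0)² ⟶ 1∕b⋆`.**  Same hypotheses with the family pinned in the infrared, `r_K(K) = g` for all K (Theorem 2's rows at one endpoint), and `b⋆ ≠ 0` (e.g. `b⋆ > 0`)
⟹ `K · r_K(0)² → 1∕b⋆`: the bare coupling of the tuned family is asymptotically free with THE coefficient `b⋆`, the same for every pin. [cite: Balaban1987RG1, (0.20) p.256, Thm 2 (0.31) p.259] -/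
theorem tendsto_mul_bare_sq (hL : HistLipschitz Λ γ β) (hΛ : FadingMemory C θ Λ) (hS : ScaleShiftRate c θ γ β)
    (hθ0 : 0 ≤ θ) (hθ1 : θ < 1) (hC : 0 ≤ C) {bstar : ℝ}
    (hb : ∀ u : ℝ, 0 < u → u ≤ γ → |betaInf β (fun _ : ℕ => u) - bstar| ≤ C * u / (1 - θ)) (hb0 : bstar ≠ 0)
    {δ₀ b : ℝ} {k₁ : ℕ} (hδ₀ : 0 < δ₀) (hδ₀γ : δ₀ ≤ γ) (hfl : EventualLowerH b δ₀ k₁ β) (hbpos : 0 < b)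
    {r : ℕ → ℕ → ℝ} (hrg : ∀ K, RGEqH K β (r K)) (hI : ∀ K, Step.InInterval δ₀ K (r K)) {g : ℝ} (hpin : ∀ K, r K K = g) :
    Tendsto (fun K : ℕ => (K : ℝ) * (r K 0) ^ 2) atTop (𝓝 (1 / bstar)) := by
  have hmain := tendsto_totalRunning_div hL hΛ hS hθ0 hθ1 hC hb hδ₀ hδ₀γ hfl hbpos hrg hI
  -- 1/(g² K) → 0, so (1/r_K(0)²)/K → b⋆
  have hpinK : Tendsto (fun K : ℕ => (1 / g ^ 2) / (K : ℝ)) atTop (𝓝 0) :=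
    tendsto_const_nhds.div_atTop tendsto_natCast_atTop_atTop
  have hsum : Tendsto (fun K : ℕ => (1 / (r K 0) ^ 2 - 1 / (r K K) ^ 2) / K + (1 / g ^ 2) / (K : ℝ)) atTop (𝓝 (bstar + 0)) :=
    hmain.add hpinK
  rw [add_zero] at hsum
  have hinv : Tendsto (fun K : ℕ => 1 / (r K 0) ^ 2 / (K : ℝ)) atTop (𝓝 bstar) := by
    refine hsum.congr' ?_
    filter_upwards [eventually_gt_atTop 0] with K hK
    rw [hpin K]
    field_simp
    ring
  -- invert
  have hinv' := hinv.inv₀ hb0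
  refine (hinv'.congr' ?_).trans (by rw [one_div])
  filter_upwards [eventually_gt_atTop 0] with K hK
  have hKpos : (0 : ℝ) < K := by exact_mod_cast hK
  have hr0 : 0 < r K 0 := ((hI K) 0 (Nat.zero_le K)).1
  field_simp

/-- The floor hypothesis of §2 from `b⋆ > 0` on a small box: if `4Cδ₀ ≤ b⋆(1−θ)` and `cθ^{k₁} ≤ (1−θ)b⋆∕4` then `EventualLowerH (b⋆∕4) δ₀ k₁ β` (part 11's `eventualLowerH_bstar`). [folklore] -/
theorem eventualLowerH_of_bstar_pos (hL : HistLipschitz Λ γ β) (hΛ : FadingMemory C θ Λ) (hS : ScaleShiftRate c θ γ β)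
    (hθ0 : 0 ≤ θ) (hθ1 : θ < 1) (hC : 0 ≤ C) {bstar : ℝ}
    (hb : ∀ u : ℝ, 0 < u → u ≤ γ → |betaInf β (fun _ : ℕ => u) - bstar| ≤ C * u / (1 - θ))
    {δ₀ : ℝ} {k₁ : ℕ} (hδ₀ : 0 < δ₀) (hδ₀γ : δ₀ ≤ γ) (hsmall : 4 * C * δ₀ ≤ bstar * (1 - θ)) (hk₁ : c * θ ^ k₁ ≤ (1 - θ) * bstar / 4) :
    EventualLowerH (bstar / 4) δ₀ k₁ β := by
  intro k v hk hv
  have h1θ : 0 < 1 - θ := by linarith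
  have h := eventualLowerH_bstar hL hΛ hS hθ0 hθ1 hC hb hδ₀ hδ₀γ k₁ k v hk hv
  have h1 : 2 * C * δ₀ / (1 - θ) ≤ bstar / 2 := by rw [div_le_iff₀ h1θ]; linarith
  have h2 : c * θ ^ k₁ / (1 - θ) ≤ bstar / 4 := by rw [div_le_iff₀ h1θ]; linarith
  linarith

end

end Summit.QuantumFields.BalabanUV.Beta.EriceFlowEnclosureB12AsPrintedPointwiseFadingLimitSharp
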